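import Literature.NumberTheory.EllipticCurves.Rank1Residual.X11aPrintCertificates.ClaimMuTable
import Literature.NumberTheory.EllipticCurves.PAdicLFunctionInterpolationProofs
import HarnessLib

/-!
# Class X11a — PRINT-route certificate records: the EXACT Riemann sum of a μ symbol table, and the
# Teichmüller-coset evaluation of the kernel's Riemann sums (the bridge behind `MuTable.ClaimFor`)

Cell `bsd-print-x11a` (D-0131 (2) print tier), typer seat ty2 (the discharge interface), part 8b,
Literature side. Companion of `ClaimMuTable.lean` (ty3: the μ SYMBOL TABLE `MuTable` of a pair — the
complete level-`n` table of plus modular symbols `x(a/pⁿ)`, every unit `a mod pⁿ` — its mod-`p` recheck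
`MuTable.check`, and the table's CLAIM `MuTable.ClaimFor W`: a newform `f₀` of `W`, `ϖ₀`, a `p`-unit
`u` with `u·ϖ₀·[a/pⁿ]⁺_{f₀}` = the displayed value at every entry).

THE POINT. The tree theorem `Summit.….X11b.ClassClosure.unitCoeffAt_of_symbolTable_modP` (and the cell's
part 8, `Summits/…/X11a/PrintDischargeMuTable.lean`) concludes `X11a.MuAnZeroAt W p` from ONE unit
RIEMANN SUM `‖RS k n₀‖_p = 1`, where `RS k n₀` is an ABSTRACT finite sum over the Teichmüller
representatives `ξ ∈ μ_{p−1}(ℤ_p)` (Mathlib's `rootsOfUnity (torsionOrder p) ℤ_[p]`) and `s mod p^{n₀}` of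
`x((ξ·γ^s mod p^{n₀+1})/p^{n₀+1})·(s choose k)` (`γ = 1 + p`). A displayed table cannot be plugged into
that sum by `decide`: the summation runs over elements of `ℤ_p`. THIS FILE supplies the missing
EVALUATION, for odd `p`:

* §1 `finsum_rootsOfUnity_eq_sum_range` — **`∑_{ξ ∈ μ_{p−1}} G(ξ mod p^{n₀+1}) = ∑_{c < p−1} G((c+1)^{p^{n₀}})`**:
  the reductions of the Teichmüller representatives modulo `p^{n₀+1}` are exactly the classes
  `(c+1)^{p^{n₀}}` (`ω(a) ≡ a^{p^{n₀}} (mod p^{n₀+1})`: a `(p−1)`-th root of unity `y` modulo `p^{n₀+1}`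
  satisfies `y = y^{p^{n₀}}`, and `a^{p^{n₀}} mod p^{n₀+1}` depends only on `a mod p`, Mathlib
  `dvd_sub_pow_of_dvd_sub`; the representatives are distinct modulo `p`, tree `classMap_injective`, and
  there are `p − 1` of them, tree `card_rootsOfUnity_torsionOrder`); `finsum_sum_classes_eq_sum_range`
  is the double-sum form `∑_ξ ∑_{s mod p^{n₀}} H(ξγ^s, s) = ∑_{s<p^{n₀}} ∑_{c<p−1} H((c+1)^{p^{n₀}}(1+p)^s, s)`
  in which the Riemann sums are written;
* §2 `MuTable.entry` / `cosetIndex` / `cosetSum` / `riemannSum` — the EXACT rational Riemann sum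
  `RS_k = ∑_{s<p^{n−1}} (s choose k)·∑_{c<p−1} x(a_{c,s}/pⁿ)`, `a_{c,s} = (c+1)^{p^{n−1}}(1+p)^s mod pⁿ`, read
  off the displayed table, and the kernel check `MuTable.checkRiemannSum` (level `n ≥ 1`; every `a_{c,s}`
  displayed; `lam < p^{n−1}`; `lam ≥ 1` on a split table; `p ∤ num(RS_lam)`, `p ∤ den(RS_lam)`) with its
  unpacking `checkRiemannSum_spec` — a SECOND, independent recomputation of the datum `MuTable.check`
  certifies modulo `p` (there: `RS_lam ≢ 0 (mod p)` via residues and modular inverses; here: the exact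
  value);
* §3 `MuTable.finsum_riemann_eq_cast_riemannSum[_signed]` — under the table identification
  (`∀ v ∈ t.values, x(v.1/pⁿ) = v.num/v.den`, i.e. `MuTable.ClaimFor` once `f₀, ϖ₀, u` are fixed) the
  abstract Riemann sum at level `n₀ = n − 1` IS (the cast of) `t.riemannSum k` (times the sign
  `(−1)^{n}` for the signed sums of a non-split `p`), and `norm_ratCast_eq_one_of_not_dvd`:
  `p ∤ num q`, `p ∤ den q` ⇒ `‖q‖_p = 1`.

So a certified table with its claim gives the `hunit` input of the X11b theorem BY THE KERNEL; the
composition with the class (`p` odd multiplicative, `E[p]` irreducible, Mazur's fact for `‖ϖ₀‖_p = 1`,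
the `p`-integrality of `L(E,1)/Ω_E`) is Summits-side (`X11a/PrintDischargeMuTableRecords.lean`).
Nothing here is a named fact; nothing is asserted about elliptic curves; per pair (E1 currency).

References: L. C. Washington, *Introduction to Cyclotomic Fields*, GTM 83, §5.1 (Teichmüller character
`ω(a) ≡ a^{p^{n}} mod p^{n+1}`), §7.2 [Washington1997]; B. Mazur, J. Tate, J. Teitelbaum, Invent. Math. 84
(1986) §I.10, §I.12–§I.13 [MazurTateTeitelbaum1986Invent]; W. Stein, C. Wuthrich, Math. Comp. 82 (2013)
§3 (3.2)–(3.5) [SteinWuthrich2013]; tree files `PAdicLFunctionInterpolationProofs.lean` (`torsionOrder`,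
`cyclotomicGenerator`, `classMap_injective`, `card_rootsOfUnity_torsionOrder`), `ClaimMuTable.lean`.
-/

set_option autoImplicit false

open scoped Classical

namespace Literature.NumberTheory.EllipticCurves.Rank1Residual.X11aPrintCertificates

open Literature.NumberTheory.EllipticCurves

/-! ### §1 The Teichmüller representatives modulo `p^{n₀+1}` (odd `p`) -/

section Teichmuller

variable (p : ℕ) [Fact p.Prime]

/-- Reindexing a sum over `ℤ/N` by the representatives `0 ≤ s < N`. [folklore] -/
private theorem sum_zmod_val_eq_sum_range (N : ℕ) [NeZero N] {R : Type*} [AddCommMonoid R] (F : ℕ → R) :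
    ∑ s : ZMod N, F s.val = ∑ s ∈ Finset.range N, F s := by
  refine Finset.sum_nbij (fun s : ZMod N ↦ s.val) (fun s _ ↦ Finset.mem_range.mpr (ZMod.val_lt s))
    (fun a _ b _ h ↦ ZMod.val_injective _ h) (fun i hi ↦ ?_) (fun _ _ ↦ rfl)
  refine ⟨(i : ZMod N), Finset.mem_coe.mpr (Finset.mem_univ _), ?_⟩
  exact ZMod.val_natCast_of_lt (Finset.mem_range.mp (Finset.mem_coe.mp hi))

/-- **The Teichmüller representatives modulo `p^{n₀+e₀}`, odd `p`**: summing `G(ξ mod p^{n₀+1})` over the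
`(p−1)`-th roots of unity `ξ` of `ℤ_p` is summing `G((c+1)^{p^{n₀}})` over `c < p − 1` — the reductions
of the Teichmüller representatives are exactly the classes `a^{p^{n₀}}`, `0 < a < p`
(`ω(a) ≡ a^{p^{n₀}} (mod p^{n₀+1})`): a unit `y` with `y^{p−1} = 1` equals `y^{p^{n₀}}`
(`p − 1 ∣ p^{n₀} − 1`), `y^{p^{n₀}} ≡ (y mod p)^{p^{n₀}} (mod p^{n₀+1})` (`dvd_sub_pow_of_dvd_sub`), the
representatives are distinct modulo `p^{n₀+1}` (`classMap_injective`) and there are `p − 1` of them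
(`card_rootsOfUnity_torsionOrder`). [cite: Washington1997, §5.1 (the Teichmüller character) and §7.2] -/
theorem finsum_rootsOfUnity_eq_sum_range (hp2 : p ≠ 2) (n₀ : ℕ) {R : Type*} [AddCommMonoid R]
    (G : ZMod (p ^ (n₀ + cyclotomicExponent p)) → R) :
    ∑ᶠ ξ : rootsOfUnity (torsionOrder p) ℤ_[p],
        G (PadicInt.toZModPow (n₀ + cyclotomicExponent p) ((ξ : ℤ_[p]ˣ) : ℤ_[p])) =
      ∑ c ∈ Finset.range (p - 1),
        G ((((c + 1) ^ (p ^ n₀) : ℕ)) : ZMod (p ^ (n₀ + cyclotomicExponent p))) := by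
  classical
  haveI := neZero_torsionOrder p
  haveI := Fintype.ofFinite (rootsOfUnity (torsionOrder p) ℤ_[p])
  have hP : p.Prime := Fact.out
  have he : cyclotomicExponent p = 1 := if_neg hp2
  have hτ : torsionOrder p = p - 1 := by rw [torsionOrder_eq, if_neg hp2]
  haveI : NeZero (p ^ (n₀ + cyclotomicExponent p)) := ⟨pow_ne_zero _ hP.ne_zero⟩
  haveI : NeZero (p ^ n₀) := ⟨pow_ne_zero _ hP.ne_zero⟩
  have hM1 : n₀ + cyclotomicExponent p = n₀ + 1 := by rw [he]
  set ψ : rootsOfUnity (torsionOrder p) ℤ_[p] → ZMod (p ^ (n₀ + cyclotomicExponent p)) :=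
    fun ξ ↦ PadicInt.toZModPow (n₀ + cyclotomicExponent p) ((ξ : ℤ_[p]ˣ) : ℤ_[p]) with hψ
  set θ : ℕ → ZMod (p ^ (n₀ + cyclotomicExponent p)) :=
    fun c ↦ (((c + 1) ^ (p ^ n₀) : ℕ) : ZMod (p ^ (n₀ + cyclotomicExponent p))) with hθ
  -- the representatives are distinct modulo `p^{n₀+1}` (the class map at `s = 0`)
  have hinj : Function.Injective ψ := by
    intro ξ ξ' h
    have h2 := classMap_injective p n₀ (a₁ := (ξ, 0)) (a₂ := (ξ', 0)) (by
      show PadicInt.toZModPow (n₀ + cyclotomicExponent p) ((ξ : ℤ_[p]ˣ) : ℤ_[p]) *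
          (cyclotomicGenerator p : ZMod (p ^ (n₀ + cyclotomicExponent p))) ^ (0 : ZMod (p ^ n₀)).val =
        PadicInt.toZModPow (n₀ + cyclotomicExponent p) ((ξ' : ℤ_[p]ˣ) : ℤ_[p]) *
          (cyclotomicGenerator p : ZMod (p ^ (n₀ + cyclotomicExponent p))) ^ (0 : ZMod (p ^ n₀)).val
      have h' : PadicInt.toZModPow (n₀ + cyclotomicExponent p) ((ξ : ℤ_[p]ˣ) : ℤ_[p]) =
          PadicInt.toZModPow (n₀ + cyclotomicExponent p) ((ξ' : ℤ_[p]ˣ) : ℤ_[p]) := h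
      rw [h'])
    exact (Prod.ext_iff.mp h2).1
  -- every representative is some `(c+1)^{p^{n₀}}`
  have hsub : Finset.univ.image ψ ⊆ (Finset.range (p - 1)).image θ := by
    intro y hy
    obtain ⟨ξ, -, rfl⟩ := Finset.mem_image.mp hy
    have hy1 : ψ ξ ^ (p - 1) = 1 := by
      rw [hψ, ← map_pow, ← hτ, rootsOfUnity_pow_torsionOrder, map_one]
    have hyu : IsUnit (ψ ξ) := by rw [hψ]; exact (Units.isUnit _).map _
    have hya : (((ψ ξ).val : ℕ) : ZMod (p ^ (n₀ + cyclotomicExponent p))) = ψ ξ :=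
      ZMod.natCast_zmod_val _
    have hcop : ¬ p ∣ (ψ ξ).val := by
      intro hdvd
      have hc : ((ψ ξ).val).Coprime (p ^ (n₀ + cyclotomicExponent p)) :=
        (ZMod.isUnit_iff_coprime _ _).mp (by rwa [hya])
      have hc' : ((ψ ξ).val).Coprime p :=
        (Nat.coprime_pow_right_iff (by rw [hM1]; omega) _ _).mp hc
      exact hP.one_lt.ne' (Nat.Coprime.eq_one_of_dvd hc'.symm hdvd)
    set a : ℕ := (ψ ξ).val with ha
    have hcpos : 0 < a % p := Nat.pos_of_ne_zero fun h0 ↦ hcop (Nat.dvd_of_mod_eq_zero h0)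
    have hclt : a % p < p := Nat.mod_lt _ hP.pos
    refine Finset.mem_image.mpr ⟨a % p - 1, Finset.mem_range.mpr (by omega), ?_⟩
    rw [hθ]
    dsimp only
    rw [Nat.sub_add_cancel hcpos]
    -- (i) `y = y ^ p^{n₀}`
    obtain ⟨K, hK⟩ : p - 1 ∣ p ^ n₀ - 1 := by
      simpa using Nat.sub_dvd_pow_sub_pow p 1 n₀
    have hpow : ψ ξ ^ (p ^ n₀) = ψ ξ := by
      have h1 : p ^ n₀ = (p - 1) * K + 1 := by
        have := Nat.one_le_pow n₀ p hP.pos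
        omega
      rw [h1, pow_succ, pow_mul, hy1, one_pow, one_mul]
    -- (ii) `a^{p^{n₀}} ≡ (a mod p)^{p^{n₀}} (mod p^{n₀+1})`
    have hmod : (p : ℤ) ∣ (a : ℤ) - ((a % p : ℕ) : ℤ) := by
      have h := (Nat.mod_modEq a p).symm.dvd
      rw [dvd_sub_comm] at h
      exact_mod_cast h
    have hlift := dvd_sub_pow_of_dvd_sub hmod n₀
    have hcast : (((a : ℤ) ^ p ^ n₀ : ℤ) : ZMod (p ^ (n₀ + cyclotomicExponent p))) =
        ((((a % p : ℕ) : ℤ) ^ p ^ n₀ : ℤ) : ZMod (p ^ (n₀ + cyclotomicExponent p))) := by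
      rw [ZMod.intCast_eq_intCast_iff_dvd_sub, hM1, dvd_sub_comm, Nat.cast_pow]
      exact hlift
    calc ((((a % p) ^ (p ^ n₀) : ℕ)) : ZMod (p ^ (n₀ + cyclotomicExponent p)))
        = ((((a % p : ℕ) : ℤ) ^ p ^ n₀ : ℤ) : ZMod (p ^ (n₀ + cyclotomicExponent p))) := by
          rw [Nat.cast_pow, Int.cast_pow, Int.cast_natCast]
      _ = (((a : ℤ) ^ p ^ n₀ : ℤ) : ZMod (p ^ (n₀ + cyclotomicExponent p))) := hcast.symm
      _ = ((a : ℕ) : ZMod (p ^ (n₀ + cyclotomicExponent p))) ^ p ^ n₀ := by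
          rw [Int.cast_pow, Int.cast_natCast]
      _ = ψ ξ := by rw [ha, hya, hpow]
  -- cardinalities: both images have `p − 1` elements, hence coincide, and `θ` is injective on the range
  have hcardS : (Finset.univ.image ψ).card = p - 1 := by
    rw [Finset.card_image_of_injective _ hinj, Finset.card_univ, ← Nat.card_eq_fintype_card,
      card_rootsOfUnity_torsionOrder, hτ]
  have hcardT : ((Finset.range (p - 1)).image θ).card ≤ p - 1 :=
    Finset.card_image_le.trans (Finset.card_range _).le
  have himg : Finset.univ.image ψ = (Finset.range (p - 1)).image θ :=
    Finset.eq_of_subset_of_card_le hsub (by rw [hcardS]; exact hcardT)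
  have hInjOn : Set.InjOn θ (Finset.range (p - 1)) := by
    rw [← Finset.card_image_iff]
    refine le_antisymm Finset.card_image_le ?_
    rw [← himg, hcardS, Finset.card_range]
  have key : ∑ ξ : rootsOfUnity (torsionOrder p) ℤ_[p], G (ψ ξ) =
      ∑ c ∈ Finset.range (p - 1), G (θ c) := by
    rw [← Finset.sum_image (f := G) fun ξ _ ξ' _ h ↦ hinj h, himg, Finset.sum_image hInjOn]
  rw [finsum_eq_sum_of_fintype]
  simpa only [hψ, hθ] using key

/-- **The classes `ξγ^s` in representatives**: for odd `p`,
`∑_ξ ∑_{s mod p^{n₀}} H(ξγ^s mod p^{n₀+1}, s) = ∑_{s<p^{n₀}} ∑_{c<p−1} H((c+1)^{p^{n₀}}(1+p)^s mod p^{n₀+1}, s)`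
(`γ = 1 + p`; the Teichmüller coset of `γ^s` is `{(c+1)^{p^{n₀}}γ^s}`), the shape in which a finite table
evaluates the Riemann sums of Mazur–Tate–Teitelbaum. [cite: Washington1997, §5.1 and §7.2]
[cite: MazurTateTeitelbaum1986Invent, §I.13 (the Riemann sums over the classes a mod pⁿ)] -/
theorem finsum_sum_classes_eq_sum_range (hp2 : p ≠ 2) (n₀ : ℕ) {R : Type*} [AddCommMonoid R]
    (H : ZMod (p ^ (n₀ + cyclotomicExponent p)) → ℕ → R) :
    ∑ᶠ ξ : rootsOfUnity (torsionOrder p) ℤ_[p], ∑ s : ZMod (p ^ n₀),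
        H (PadicInt.toZModPow (n₀ + cyclotomicExponent p) ((ξ : ℤ_[p]ˣ) : ℤ_[p]) *
            (cyclotomicGenerator p : ZMod (p ^ (n₀ + cyclotomicExponent p))) ^ s.val) s.val =
      ∑ s ∈ Finset.range (p ^ n₀), ∑ c ∈ Finset.range (p - 1),
        H ((((c + 1) ^ (p ^ n₀) * (1 + p) ^ s : ℕ)) : ZMod (p ^ (n₀ + cyclotomicExponent p))) s := by
  classical
  haveI := neZero_torsionOrder p
  haveI := Fintype.ofFinite (rootsOfUnity (torsionOrder p) ℤ_[p])
  have hP : p.Prime := Fact.out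
  haveI : NeZero (p ^ n₀) := ⟨pow_ne_zero _ hP.ne_zero⟩
  have he : cyclotomicExponent p = 1 := if_neg hp2
  have hγ : cyclotomicGenerator p = 1 + p := by rw [cyclotomicGenerator, he, pow_one]
  rw [finsum_eq_sum_of_fintype, Finset.sum_comm]
  rw [sum_zmod_val_eq_sum_range (p ^ n₀) (fun s ↦ ∑ ξ : rootsOfUnity (torsionOrder p) ℤ_[p],
    H (PadicInt.toZModPow (n₀ + cyclotomicExponent p) ((ξ : ℤ_[p]ˣ) : ℤ_[p]) *
      (cyclotomicGenerator p : ZMod (p ^ (n₀ + cyclotomicExponent p))) ^ s) s)]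
  refine Finset.sum_congr rfl fun s _ ↦ ?_
  rw [← finsum_eq_sum_of_fintype, finsum_rootsOfUnity_eq_sum_range p hp2 n₀ (fun y ↦
    H (y * (cyclotomicGenerator p : ZMod (p ^ (n₀ + cyclotomicExponent p))) ^ s) s)]
  refine Finset.sum_congr rfl fun c _ ↦ ?_
  rw [hγ]
  push_cast
  ring_nf

end Teichmuller

/-! ### §2 The exact Riemann sum of a μ symbol table and its kernel check -/

namespace MuTable

variable (t : MuTable)

/-- The displayed value `x(a/pⁿ) = num/den` of the table at the argument `a` (junk `0` if `a` is not a
displayed argument — excluded by `checkRiemannSum` for the arguments that are used).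
[cite: MazurTateTeitelbaum1986Invent, §I.10] -/
def entry (a : ℕ) : ℚ :=
  match t.values.find? (fun v => v.1 == a) with
  | some v => (v.2.1 : ℚ) / (v.2.2 : ℚ)
  | none => 0

/-- The Teichmüller-coset argument `a_{c,s} = (c+1)^{p^{n−1}}·(1+p)^s mod pⁿ`
(`(c+1)^{p^{n−1}} ≡ ω(c+1)`, `γ = 1 + p`). [cite: Washington1997, §5.1 and §7.2] -/
def cosetIndex (c s : ℕ) : ℕ := ((c + 1) ^ (t.p ^ (t.n - 1)) * (1 + t.p) ^ s) % t.p ^ t.n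

/-- The Teichmüller-COSET SUM `c_s = ∑_{c<p−1} x(a_{c,s}/pⁿ)` of the table (exact).
[cite: MazurTateTeitelbaum1986Invent, §I.10 (μ_E(a + pⁿℤ_p) = a_p⁻ⁿ x(a/pⁿ))] -/
def cosetSum (s : ℕ) : ℚ := ∑ c ∈ Finset.range (t.p - 1), t.entry (t.cosetIndex c s)

/-- The EXACT RIEMANN SUM `RS_k = ∑_{s<p^{n−1}} (s choose k)·c_s` of the table at level `n − 1` (the
binomial as `s^{(k)}/k!`, cheap for the kernel; `= s.choose k`, `riemannSum_eq`).
[cite: SteinWuthrich2013, §3 (3.3)–(3.5)] [cite: MazurTateTeitelbaum1986Invent, §I.13] -/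
def riemannSum (k : ℕ) : ℚ :=
  ∑ s ∈ Finset.range (t.p ^ (t.n - 1)), ((s.descFactorial k / k.factorial : ℕ) : ℚ) * t.cosetSum s

/-- Every Teichmüller-coset argument `a_{c,s}` (`s < p^{n−1}`, `c < p − 1`) is a displayed argument.
[cite: MazurTateTeitelbaum1986Invent, §I.10] -/
def complete : Bool :=
  (List.range (t.p ^ (t.n - 1))).all fun s =>
    (List.range (t.p - 1)).all fun c => (t.values.find? (fun v => v.1 == t.cosetIndex c s)).isSome

/-- **The kernel check of the exact Riemann sum**: `n ≥ 1`, the table is complete on the Teichmüller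
cosets, `lam < p^{n−1}`, `lam ≥ 1` if the table is filed as split (the coefficient certified at a split
`p` is `lam = (lam − 1) + 1`, past the trivial zero), and `RS_lam = num/den` with `p ∤ num`, `p ∤ den`
(so `‖RS_lam‖_p = 1`). [cite: SteinWuthrich2013, §3 (3.5) and §4.2] -/
def checkRiemannSum : Bool :=
  decide (1 ≤ t.n) && t.complete && decide (t.lam < t.p ^ (t.n - 1)) &&
    (!t.split || decide (1 ≤ t.lam)) &&
    decide ((t.riemannSum t.lam).num % (t.p : ℤ) ≠ 0) && decide ((t.riemannSum t.lam).den % t.p ≠ 0)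

/-- The binomial of `riemannSum` is `s.choose k`: `RS_k = ∑_s (s choose k)·c_s`, the Riemann sum of
Stein–Wuthrich in the binomial basis `T = (1+T) − 1`. [cite: SteinWuthrich2013, §3 (3.3)–(3.5)] -/
theorem riemannSum_eq (k : ℕ) :
    t.riemannSum k = ∑ s ∈ Finset.range (t.p ^ (t.n - 1)), ((s.choose k : ℕ) : ℚ) * t.cosetSum s := by
  unfold riemannSum
  refine Finset.sum_congr rfl fun s _ ↦ ?_
  rw [Nat.choose_eq_descFactorial_div_factorial]

/-- A complete table displays every coset argument: `a_{c,s}` is the argument of an entry `(a, num, den)`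
and `entry a_{c,s} = num/den`. [cite: MazurTateTeitelbaum1986Invent, §I.10] -/
theorem exists_entry_of_complete (hc : t.complete = true) {s c : ℕ} (hs : s < t.p ^ (t.n - 1))
    (hc' : c < t.p - 1) :
    ∃ v ∈ t.values, v.1 = t.cosetIndex c s ∧ t.entry (t.cosetIndex c s) = (v.2.1 : ℚ) / (v.2.2 : ℚ) := by
  unfold complete at hc
  have h1 := List.all_eq_true.mp hc s (List.mem_range.mpr hs)
  have h2 := List.all_eq_true.mp h1 c (List.mem_range.mpr hc')
  obtain ⟨v, hv⟩ := Option.isSome_iff_exists.mp h2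
  refine ⟨v, List.mem_of_find?_eq_some hv, ?_, ?_⟩
  · have h := List.find?_some hv
    exact beq_iff_eq.mp h
  · simp only [entry, hv]

/-- Unpacking `checkRiemannSum`. [cite: SteinWuthrich2013, §3 (3.5)] -/
theorem checkRiemannSum_spec (h : t.checkRiemannSum = true) :
    1 ≤ t.n ∧ t.complete = true ∧ t.lam < t.p ^ (t.n - 1) ∧ (t.split = true → 1 ≤ t.lam) ∧
      ¬ ((t.p : ℤ) ∣ (t.riemannSum t.lam).num) ∧ ¬ (t.p ∣ (t.riemannSum t.lam).den) := by
  unfold checkRiemannSum at h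
  simp only [Bool.and_eq_true, decide_eq_true_eq, Bool.or_eq_true, Bool.not_eq_true'] at h
  obtain ⟨⟨⟨⟨⟨h1, h2⟩, h3⟩, h4⟩, h5⟩, h6⟩ := h
  refine ⟨h1, h2, h3, fun hs ↦ ?_, fun hd ↦ h5 (Int.emod_eq_zero_of_dvd hd),
    fun hd ↦ h6 (Nat.mod_eq_zero_of_dvd hd)⟩
  rcases h4 with h4 | h4
  · rw [hs] at h4; exact absurd h4 (by decide)
  · exact h4

/-! ### §3 The abstract Riemann sums of Mazur–Tate–Teitelbaum ARE the table's exact Riemann sums -/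

/-- **Teichmüller-coset evaluation of the Riemann sums (unsigned / split shape).** For odd `p = t.p`,
a table of level `n ≥ 1` complete on the Teichmüller cosets, and a function `x` with the TABLE
IDENTIFICATION `x(a/pⁿ) = num/den` at every displayed entry (`MuTable.ClaimFor` with `f₀, ϖ₀, u` fixed,
`x = u·ϖ₀·[·]⁺_{f₀}`): the abstract Riemann sum at level `n₀ = n − 1`,
`∑_{ξ ∈ μ_{p−1}} ∑_{s mod p^{n₀}} x((ξγ^s mod pⁿ)/pⁿ)·(s choose k)` — the `RS k n₀` of
`X11b.ClassClosure.unitCoeffAt_of_symbolTable_modP` / `X11a.unitCoeffAt_of_symbolTable_rankFree` — is the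
cast of the exact rational `t.riemannSum k`. [cite: MazurTateTeitelbaum1986Invent, §I.10 and §I.13]
[cite: SteinWuthrich2013, §3 (3.2)–(3.5)] [cite: Washington1997, §5.1 and §7.2] -/
theorem finsum_riemann_eq_cast_riemannSum {p : ℕ} [Fact p.Prime] (hp : t.p = p) (hp2 : p ≠ 2)
    (hn : 1 ≤ t.n) (hc : t.complete = true) {x : ℚ → ℚ}
    (hx : ∀ v ∈ t.values, x ((v.1 : ℚ) / (p : ℚ) ^ t.n) = (v.2.1 : ℚ) / (v.2.2 : ℚ)) (k : ℕ) :
    ∑ᶠ ξ : rootsOfUnity (torsionOrder p) ℤ_[p], ∑ s : ZMod (p ^ (t.n - 1)),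
        (x (((PadicInt.toZModPow (t.n - 1 + cyclotomicExponent p) ((ξ : ℤ_[p]ˣ) : ℤ_[p]) *
              (cyclotomicGenerator p : ZMod (p ^ (t.n - 1 + cyclotomicExponent p))) ^ s.val).val : ℚ) /
            (p : ℚ) ^ (t.n - 1 + cyclotomicExponent p)) : ℚ_[p]) * ((s.val.choose k : ℕ) : ℚ_[p]) =
      ((t.riemannSum k : ℚ) : ℚ_[p]) := by
  subst hp
  have he : cyclotomicExponent t.p = 1 := if_neg hp2
  have hM : t.n - 1 + cyclotomicExponent t.p = t.n := by rw [he]; omega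
  rw [finsum_sum_classes_eq_sum_range t.p hp2 (t.n - 1) (fun A s ↦
    (x ((A.val : ℚ) / (t.p : ℚ) ^ (t.n - 1 + cyclotomicExponent t.p)) : ℚ_[t.p]) *
      ((s.choose k : ℕ) : ℚ_[t.p]))]
  rw [riemannSum_eq, Rat.cast_sum]
  refine Finset.sum_congr rfl fun s hs ↦ ?_
  rw [Rat.cast_mul, Rat.cast_natCast, cosetSum, Rat.cast_sum, Finset.mul_sum]
  refine Finset.sum_congr rfl fun c hc' ↦ ?_
  obtain ⟨v, hv, hv1, hve⟩ := t.exists_entry_of_complete hc (Finset.mem_range.mp hs)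
    (Finset.mem_range.mp hc')
  rw [mul_comm, ZMod.val_natCast, hM, ← cosetIndex, hve, ← hv1, ← hx v hv]

/-- **Signed shape (non-split `p`)**: the same evaluation for the SIGNED Riemann sums
`∑_ξ ∑_s (−1)ⁿ·x(…)·(s choose k)` of `X11a.unitCoeffAt_of_symbolTable_rankFree` (`a_p = −1`: the measure
is `(−1)ⁿ x(a/pⁿ)` at level `n`) — `= (−1)ⁿ·t.riemannSum k`, the sign being immaterial for the norm.
[cite: MazurTateTeitelbaum1986Invent, §I.10 Prop. (a_p = −1) and §I.13] [cite: SteinWuthrich2013, §3 (3.2)–(3.5)] -/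
theorem finsum_riemann_eq_cast_riemannSum_signed {p : ℕ} [Fact p.Prime] (hp : t.p = p) (hp2 : p ≠ 2)
    (hn : 1 ≤ t.n) (hc : t.complete = true) {x : ℚ → ℚ}
    (hx : ∀ v ∈ t.values, x ((v.1 : ℚ) / (p : ℚ) ^ t.n) = (v.2.1 : ℚ) / (v.2.2 : ℚ)) (k : ℕ) :
    ∑ᶠ ξ : rootsOfUnity (torsionOrder p) ℤ_[p], ∑ s : ZMod (p ^ (t.n - 1)),
        ((-1 : ℚ_[p]) ^ (t.n - 1 + cyclotomicExponent p) *
          (x (((PadicInt.toZModPow (t.n - 1 + cyclotomicExponent p) ((ξ : ℤ_[p]ˣ) : ℤ_[p]) *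
              (cyclotomicGenerator p : ZMod (p ^ (t.n - 1 + cyclotomicExponent p))) ^ s.val).val : ℚ) /
            (p : ℚ) ^ (t.n - 1 + cyclotomicExponent p)) : ℚ_[p])) * ((s.val.choose k : ℕ) : ℚ_[p]) =
      (-1 : ℚ_[p]) ^ t.n * ((t.riemannSum k : ℚ) : ℚ_[p]) := by
  have he : cyclotomicExponent p = 1 := if_neg hp2
  have hM : t.n - 1 + cyclotomicExponent p = t.n := by rw [he]; omega
  rw [← t.finsum_riemann_eq_cast_riemannSum hp hp2 hn hc hx k]
  classical
  haveI := neZero_torsionOrder p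
  haveI := Fintype.ofFinite (rootsOfUnity (torsionOrder p) ℤ_[p])
  rw [finsum_eq_sum_of_fintype, finsum_eq_sum_of_fintype, Finset.mul_sum]
  refine Finset.sum_congr rfl fun ξ _ ↦ ?_
  rw [Finset.mul_sum]
  refine Finset.sum_congr rfl fun s _ ↦ ?_
  rw [hM, mul_assoc]

end MuTable

/-- **`‖q‖_p = 1` for a rational with `p ∤ num q` and `p ∤ den q`** (`|x|_p = p^{−v_p(x)}`; the
kernel's currency for a unit Riemann sum).
[cite: Gouvea1993PadicNumbers, §2.1 (Def. 2.1.2: the p-adic absolute value |x|_p = p^{-v_p(x)} on ℚ)] -/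
theorem norm_ratCast_eq_one_of_not_dvd {p : ℕ} [Fact p.Prime] {q : ℚ} (hnum : ¬ ((p : ℤ) ∣ q.num))
    (hden : ¬ (p ∣ q.den)) : ‖((q : ℚ) : ℚ_[p])‖ = 1 := by
  have hn : ‖((q.num : ℤ) : ℚ_[p])‖ = 1 := by
    refine le_antisymm (Padic.norm_int_le_one _) (not_lt.mp fun hlt ↦ hnum ?_)
    exact Padic.norm_intCast_lt_one_iff.mp hlt
  have hd : ‖((q.den : ℤ) : ℚ_[p])‖ = 1 := by
    refine le_antisymm (Padic.norm_int_le_one _) (not_lt.mp fun hlt ↦ hden ?_)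
    exact Int.natCast_dvd_natCast.mp (Padic.norm_intCast_lt_one_iff.mp hlt)
  have hq : ((q : ℚ) : ℚ_[p]) = ((q.num : ℤ) : ℚ_[p]) / ((q.den : ℤ) : ℚ_[p]) := by
    conv_lhs => rw [← Rat.num_div_den q]
    rw [Rat.cast_div, Rat.cast_intCast, Rat.cast_natCast, Int.cast_natCast]
  rw [hq, norm_div, hn, hd, div_one]

/-! ### Sanity checks -/

-- `decide +kernel` on a level-2 table at p = 5: 5 coset sums of 4 table lookups, exact rationals.
set_option maxRecDepth 100000

/-- The level-2 table of `6480d1 @ 5` (display file `RecordsLeafNonSurjMuTablesPart1`): the exact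
Riemann sums are `RS_0 = 0` (the trivial zero of a split `p`), `RS_1 = 5`, `RS_2 = 30` and
`RS_3 = 24`, a `5`-adic unit — `lam = 3`, and the check passes; a copy filed with `lam := 2` fails.
[cite: SteinWuthrich2013, §3] -/
example :
    ({ label := "6480d1", ainvs := [0, 0, 0, -8532, -303156], conductor := 6480, p := 5, split := true, n := 2,
       lam := 3, x0 := (5, 1),
       values := [(1, 7, 2), (2, 1, 2), (3, -1, 2), (4, 7, 2), (6, -7, 2), (7, 0, 1), (8, 0, 1), (9, 0, 1),
                  (11, -7, 2), (12, 0, 1), (13, 0, 1), (14, -7, 2), (16, 0, 1), (17, 0, 1), (18, 0, 1),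
                  (19, -7, 2), (21, 7, 2), (22, -1, 2), (23, 1, 2), (24, 7, 2)],
       engines := [] } : MuTable).checkRiemannSum = true ∧
    ({ label := "6480d1", ainvs := [0, 0, 0, -8532, -303156], conductor := 6480, p := 5, split := true, n := 2,
       lam := 3, x0 := (5, 1),
       values := [(1, 7, 2), (2, 1, 2), (3, -1, 2), (4, 7, 2), (6, -7, 2), (7, 0, 1), (8, 0, 1), (9, 0, 1),
                  (11, -7, 2), (12, 0, 1), (13, 0, 1), (14, -7, 2), (16, 0, 1), (17, 0, 1), (18, 0, 1),
                  (19, -7, 2), (21, 7, 2), (22, -1, 2), (23, 1, 2), (24, 7, 2)],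
       engines := [] } : MuTable).riemannSum 3 = 24 ∧
    ({ label := "6480d1", ainvs := [0, 0, 0, -8532, -303156], conductor := 6480, p := 5, split := true, n := 2,
       lam := 2, x0 := (5, 1),
       values := [(1, 7, 2), (2, 1, 2), (3, -1, 2), (4, 7, 2), (6, -7, 2), (7, 0, 1), (8, 0, 1), (9, 0, 1),
                  (11, -7, 2), (12, 0, 1), (13, 0, 1), (14, -7, 2), (16, 0, 1), (17, 0, 1), (18, 0, 1),
                  (19, -7, 2), (21, 7, 2), (22, -1, 2), (23, 1, 2), (24, 7, 2)],
       engines := [] } : MuTable).checkRiemannSum = false := by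
  refine ⟨by decide +kernel, by decide +kernel, by decide +kernel⟩

end Literature.NumberTheory.EllipticCurves.Rank1Residual.X11aPrintCertificates
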